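import Summits.Ventures.HodgeRepro2.T5QuadraticConductor
import Summits.Ventures.HodgeRepro2.T5InertPrimeToy

/-!
# T5QuadraticCensusToy — the census of the inert places on one instance: `3` in `ℚ(i) = ℚ(√−1)`

Tier-5 kernel support (seat p8, blind lane; sub-step N3; README §10.5 (ii)(c)/(d) non-vacuity of
T5-173 / T5-174).  On `L = ℚ(ζ₄)` (any fourth cyclotomic extension of `ℚ`), `x = ζ₄ ∈ 𝓞_L`,
`d = −1 ∈ 𝓞_ℚ`, `v = (3)`:

* the hypotheses of the census theorem `T5QuadraticConductor.exists_map_eq_asIdeal_iff_not_isSquare`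
  are jointly satisfied (`[L : ℚ] = 2`, `ζ₄² = −1`, `ζ₄ ∉ 𝓞_ℚ`, `4·(−1) ∉ (3)`):
  `hypotheses_satisfiable`;
* read one way, the criterion turns T5-160's «`3` stays prime in `ℚ(i)`» into
  `not_isSquare_neg_one_mod_three`: `−1` is not a square in `𝓞_ℚ ⧸ (3)`;
* read the other way, Mathlib's `ZMod.exists_sq_eq_neg_one_iff` (through
  `𝓞_ℚ ⧸ (3) ≃+* ℤ ⧸ (3) ≃+* ZMod 3`, inside the proof) gives the same non-square statement independently
  (`not_isSquare_neg_one_mod_three'`), and the criterion returns a SECOND PROOF that `3` stays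
  prime in `ℚ(i)` (`exists_map_eq_asIdeal_three`), by the Legendre symbol alone — the two
  readings agree (README §10.5 (ii)(d), joint consistency).

No `sorry`, no axiom beyond `propext`, `Classical.choice`, `Quot.sound`.
-/

namespace Summit.Ventures.HodgeRepro2.T5QuadraticCensusToy

open NumberField IsDedekindDomain HeightOneSpectrum

variable (L : Type*) [Field L] [CharZero L] [IsCyclotomicExtension {2 ^ 2} ℚ L]

/-- `ζ₄ · ζ₄ = −1` in `𝓞 L` (`ζ₄²` is a primitive square root of unity). -/
theorem toInteger_mul_self :
    (IsCyclotomicExtension.zeta_spec (2 ^ 2) ℚ L).toInteger *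
        (IsCyclotomicExtension.zeta_spec (2 ^ 2) ℚ L).toInteger =
      algebraMap (𝓞 ℚ) (𝓞 L) (-1) := by
  apply FaithfulSMul.algebraMap_injective (𝓞 L) L
  have h2 : IsPrimitiveRoot (IsCyclotomicExtension.zeta (2 ^ 2) ℚ L ^ 2) 2 :=
    (IsCyclotomicExtension.zeta_spec (2 ^ 2) ℚ L).pow (by norm_num) (by norm_num)
  have h := h2.eq_neg_one_of_two_right
  have hc : algebraMap (𝓞 L) L (IsCyclotomicExtension.zeta_spec (2 ^ 2) ℚ L).toInteger =
      IsCyclotomicExtension.zeta (2 ^ 2) ℚ L :=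
    (IsCyclotomicExtension.zeta_spec (2 ^ 2) ℚ L).coe_toInteger
  rw [map_mul, hc, map_neg, map_one, map_neg, map_one, ← sq, h]

/-- `ζ₄ ∉ 𝓞_ℚ`: a rational integer with square `−1` does not exist. -/
theorem toInteger_not_mem_range :
    (IsCyclotomicExtension.zeta_spec (2 ^ 2) ℚ L).toInteger ∉
      Set.range (algebraMap (𝓞 ℚ) (𝓞 L)) := by
  rintro ⟨q, hq⟩
  have h := toInteger_mul_self L
  rw [← hq, ← map_mul] at h
  have hq2 : q * q = -1 := FaithfulSMul.algebraMap_injective (𝓞 ℚ) (𝓞 L) h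
  have h0 : (0 : ℚ) ≤ algebraMap (𝓞 ℚ) ℚ q * algebraMap (𝓞 ℚ) ℚ q := mul_self_nonneg _
  rw [← map_mul, hq2, map_neg, map_one] at h0
  norm_num at h0

/-- `4 · (−1) ∉ (3)` in `𝓞_ℚ` (along `Rat.ringOfIntegersEquiv : 𝓞 ℚ ≃+* ℤ`). -/
theorem four_mul_neg_one_not_mem :
    4 * (-1 : 𝓞 ℚ) ∉ T5InertPrimeToy.vThree.asIdeal := by
  rw [T5InertPrimeToy.vThree_asIdeal, Ideal.mem_span_singleton]
  intro h
  have h' := map_dvd Rat.ringOfIntegersEquiv h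
  rw [map_mul, map_neg, map_one, map_ofNat, map_ofNat] at h'
  norm_num at h'

/-- The hypotheses of the census theorem (T5-174) are jointly satisfied on `(ℚ(ζ₄), ζ₄, −1, (3))`
(README §10.5 (ii)(c)/(d)). -/
theorem hypotheses_satisfiable :
    ∃ (x : 𝓞 L) (d : 𝓞 ℚ) (v : HeightOneSpectrum (𝓞 ℚ)),
      Module.finrank ℚ L = 2 ∧ x * x = algebraMap (𝓞 ℚ) (𝓞 L) d ∧
        x ∉ Set.range (algebraMap (𝓞 ℚ) (𝓞 L)) ∧ 4 * d ∉ v.asIdeal :=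
  ⟨_, -1, T5InertPrimeToy.vThree, T5InertPrimeToy.finrank_eq_two L, toInteger_mul_self L,
    toInteger_not_mem_range L, four_mul_neg_one_not_mem⟩

include L in
/-- **First reading**: T5-160's «`3` stays prime in `ℚ(i)`» through the census criterion gives
«`−1` is not a square in `𝓞_ℚ ⧸ (3)`». -/
theorem not_isSquare_neg_one_mod_three :
    ¬ IsSquare (Ideal.Quotient.mk T5InertPrimeToy.vThree.asIdeal (-1 : 𝓞 ℚ)) := by
  haveI : NumberField L := IsCyclotomicExtension.numberField {2 ^ 2} ℚ L
  exact (T5QuadraticConductor.exists_map_eq_asIdeal_iff_not_isSquare T5InertPrimeToy.vThree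
    (T5InertPrimeToy.finrank_eq_two L) (toInteger_mul_self L) (toInteger_not_mem_range L)
    four_mul_neg_one_not_mem).mp ⟨T5InertPrimeToy.wThree L, T5InertPrimeToy.map_eq L⟩

/-- **Second reading, independent**: `−1` is not a square in `𝓞_ℚ ⧸ (3)` by Mathlib's
`ZMod.exists_sq_eq_neg_one_iff` (`3 % 4 = 3`), transported along
`𝓞_ℚ ⧸ (3) ≃+* ℤ ⧸ (3) ≃+* ZMod 3` (`Rat.ringOfIntegersEquiv`, `Int.quotientSpanNatEquivZMod`). -/
theorem not_isSquare_neg_one_mod_three' :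
    ¬ IsSquare (Ideal.Quotient.mk T5InertPrimeToy.vThree.asIdeal (-1 : 𝓞 ℚ)) := by
  intro h
  have e : (𝓞 ℚ ⧸ T5InertPrimeToy.vThree.asIdeal) ≃+* ZMod 3 :=
    (Ideal.quotientEquiv T5InertPrimeToy.vThree.asIdeal (Ideal.span {((3 : ℕ) : ℤ)})
      Rat.ringOfIntegersEquiv (by
        rw [T5InertPrimeToy.vThree_asIdeal, Ideal.map_span, Set.image_singleton, map_ofNat]
        simp)).trans (Int.quotientSpanNatEquivZMod 3)
  have h' := h.map e
  have he : e (Ideal.Quotient.mk T5InertPrimeToy.vThree.asIdeal (-1 : 𝓞 ℚ)) = (-1 : ZMod 3) := by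
    simp
  rw [he] at h'
  exact T5InertPrimeToy.not_isSquare_neg_one_zmod_three h'

/-- **A second proof that `3` stays prime in `ℚ(i)`**, from the Legendre symbol alone
(`−1` a non-square mod `3`) through the census criterion — agreeing with T5-160's
Kummer–Dedekind proof (`T5InertPrimeToy.map_eq`). -/
theorem exists_map_eq_asIdeal_three :
    ∃ w : HeightOneSpectrum (𝓞 L),
      T5InertPrimeToy.vThree.asIdeal.map (algebraMap (𝓞 ℚ) (𝓞 L)) = w.asIdeal := by
  haveI : NumberField L := IsCyclotomicExtension.numberField {2 ^ 2} ℚ L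
  exact (T5QuadraticConductor.exists_map_eq_asIdeal_iff_not_isSquare T5InertPrimeToy.vThree
    (T5InertPrimeToy.finrank_eq_two L) (toInteger_mul_self L) (toInteger_not_mem_range L)
    four_mul_neg_one_not_mem).mpr not_isSquare_neg_one_mod_three'

/-- The two readings agree: `(3) 𝓞_L` is prime, by the criterion. -/
theorem isPrime_map_three :
    (T5InertPrimeToy.vThree.asIdeal.map (algebraMap (𝓞 ℚ) (𝓞 L))).IsPrime := by
  haveI : NumberField L := IsCyclotomicExtension.numberField {2 ^ 2} ℚ L
  exact (T5QuadraticConductor.isPrime_map_iff_not_isSquare T5InertPrimeToy.vThree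
    (T5InertPrimeToy.finrank_eq_two L) (toInteger_mul_self L) (toInteger_not_mem_range L)
    four_mul_neg_one_not_mem).mpr not_isSquare_neg_one_mod_three'

end Summit.Ventures.HodgeRepro2.T5QuadraticCensusToy
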